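import Summits.Ventures.WeilGRH.FrontierTrivialAtTwo
import HarnessLib

/-!
# GRH arm (rh-explicit, venture WeilGRH): the `ζ` frontier `4023/5000` for EVERY character of large modulus

On the three-prime-power window `log 3 < 2a ≤ log 5` with `log 2 ≤ a` (so that `n = 2, 3, 4` are inside)
the prime `3` is reflected (`reflection_inequality_at`, `L = log 3`) and the prime powers `2` and `4` are
paid crudely: `|k(log 2)| ≤ ‖g‖₂²` (Cauchy–Schwarz, `norm_weilConv_weilReflect_le`; here `a > log 2`, the
folded windows overlap) and `2|k(log 4)| ≤ ‖g‖₂²` (`two_mul_norm_weilConv_weilReflect_le`, `a ≤ log 4 ≤ 2a`),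
out of a budget `δ ≥ 2(log 2/√2)‖1 − χ(2)‖ + (log 2/2)‖1 − χ(4)‖` (`Λ(4)/√4 = log 2/2`).

At the `ζ` FRONTIER (`EvenWinsBeyondArch.weilPositivityOn_8046`): **`WeilPositivityOnChar χ (4023/5000)` for
EVERY Dirichlet character of EVERY modulus `q ≥ 450`**, for every character of EVEN modulus `q ≥ 128`
(`χ(2) = χ(4) = 0`), and for `q ≥ 225` when `χ(2) = −1` (`χ(4) = 1`). With `WeilPositivityOnChar.mono`
every `ζ` rung `t ≤ 4023/5000` transfers to these characters: the GRH arm reaches the `ζ` frontier in the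
tree for all but finitely many moduli.

References: A. Weil (1952), (11) and the «lemme» p. 262; H. Yoshida (1992) §6.
-/

noncomputable section

open Complex Filter Set MeasureTheory
open scoped Real Topology ComplexConjugate ArithmeticFunction.vonMangoldt

namespace Summit.Ventures.WeilGRH

open Literature.NumberTheory.LFunctions

variable {q : ℕ} {g : ℝ → ℂ}

/-! ## The three-term prime difference on `[-log 5, log 5]` -/

/-- On `[-log 5, log 5]` only `n = 2, 3, 4` contribute: the difference of the `ζ` and `χ` prime terms is
the sum of the three terms `(Λ(n)/√n)·[(1 − χ(n)) k(log n) + (1 − conj χ(n)) k(−log n)]`.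
[cite: Weil1952FormulesExplicites, (11) pp. 261–262, prime term] -/
theorem weilPrimeTerm_sub_weilPrimeTermChar_three (χ : DirichletCharacter ℂ q) {k : ℝ → ℂ}
    (hk : Continuous k) (h : tsupport k ⊆ Icc (-Real.log 5) (Real.log 5)) :
    weilPrimeTerm k - weilPrimeTermChar χ k =
      ∑ n ∈ ({2, 3, 4} : Finset ℕ), ((Λ n : ℝ) : ℂ) / (Real.sqrt n : ℂ) *
        ((1 - χ (n : ZMod q)) * k (Real.log n) + (1 - conj (χ (n : ZMod q))) * k (-Real.log n)) := by
  have hsupp := support_subset_Ioo_of_tsupport_subset_Icc hk h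
  have hz : ∀ n ∉ ({2, 3, 4} : Finset ℕ),
      ((Λ n : ℝ) : ℂ) = 0 ∨ (k (Real.log n) = 0 ∧ k (-Real.log n) = 0) := by
    intro n hn
    simp only [Finset.mem_insert, Finset.mem_singleton, not_or] at hn
    rcases Nat.lt_or_ge n 5 with h5 | h5
    · left
      interval_cases n
      · simp
      · simp
      · exact absurd rfl hn.1
      · exact absurd rfl hn.2.1
      · exact absurd rfl hn.2.2
    · right
      have hlog : Real.log 5 ≤ Real.log n := Real.log_le_log (by norm_num) (by exact_mod_cast h5)
      constructor
      · by_contra hne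
        have := (hsupp hne).2
        linarith
      · by_contra hne
        have := (hsupp hne).1
        linarith
  have h1 : weilPrimeTerm k = ∑ n ∈ ({2, 3, 4} : Finset ℕ),
      ((Λ n : ℝ) : ℂ) / (Real.sqrt n : ℂ) * (k (Real.log n) + k (-Real.log n)) := by
    unfold weilPrimeTerm
    refine tsum_eq_sum fun n hn ↦ ?_
    rcases hz n hn with h0 | ⟨ha, hb⟩
    · simp [h0]
    · simp [ha, hb]
  have h2 : weilPrimeTermChar χ k = ∑ n ∈ ({2, 3, 4} : Finset ℕ),
      ((Λ n : ℝ) : ℂ) / (Real.sqrt n : ℂ) *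
        (χ (n : ZMod q) * k (Real.log n) + conj (χ (n : ZMod q)) * k (-Real.log n)) := by
    unfold weilPrimeTermChar
    refine tsum_eq_sum fun n hn ↦ ?_
    rcases hz n hn with h0 | ⟨ha, hb⟩
    · simp [h0]
    · simp [ha, hb]
  rw [h1, h2, ← Finset.sum_sub_distrib]
  refine Finset.sum_congr rfl fun n _ ↦ ?_
  ring

/-- `Re[P_ζ(k) − P_χ(k)]` on `[-log 5, log 5]` for `k = g ⋆ g̃`:
`2(log 2/√2)Re[(1−χ(2))k(log 2)] + 2(log 3/√3)Re[(1−χ(3))k(log 3)] + 2(log 2/2)Re[(1−χ(4))k(log 4)]`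
(`Λ(4) = log 2`, `√4 = 2`). [cite: Weil1952FormulesExplicites, (11) pp. 261–262, prime term] -/
theorem re_weilPrimeTerm_sub_weilPrimeTermChar_three (χ : DirichletCharacter ℂ q) (hg : IsWeilTest g)
    (h : tsupport (weilConv g (weilReflect g)) ⊆ Icc (-Real.log 5) (Real.log 5)) :
    (weilPrimeTerm (weilConv g (weilReflect g)) - weilPrimeTermChar χ (weilConv g (weilReflect g))).re =
      2 * (Real.log 2 / Real.sqrt 2) *
          ((1 - χ (2 : ZMod q)) * weilConv g (weilReflect g) (Real.log 2)).re +
        2 * (Real.log 3 / Real.sqrt 3) *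
          ((1 - χ (3 : ZMod q)) * weilConv g (weilReflect g) (Real.log 3)).re +
        2 * (Real.log 2 / 2) *
          ((1 - χ (4 : ZMod q)) * weilConv g (weilReflect g) (Real.log 4)).re := by
  set k := weilConv g (weilReflect g) with hk
  have hkc : Continuous k := (hg.weilConv hg.weilReflect).1.continuous
  rw [weilPrimeTerm_sub_weilPrimeTermChar_three χ hkc h,
    Finset.sum_insert (by norm_num), Finset.sum_pair (by norm_num), add_re, add_re]
  have hterm : ∀ (n : ℕ) (c : ℝ), ((Λ n : ℝ) : ℂ) / (Real.sqrt n : ℂ) = ((c : ℝ) : ℂ) →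
      (((Λ n : ℝ) : ℂ) / (Real.sqrt n : ℂ) *
        ((1 - χ (n : ZMod q)) * k (Real.log n) + (1 - conj (χ (n : ZMod q))) * k (-Real.log n))).re =
      2 * c * ((1 - χ (n : ZMod q)) * k (Real.log n)).re := by
    intro n c hc
    have hneg : k (-Real.log n) = conj (k (Real.log n)) := by
      rw [hk, ← conj_weilConv_weilReflect_neg g (Real.log n), Complex.conj_conj]
    set z : ℂ := (1 - χ (n : ZMod q)) * k (Real.log n) with hz
    have hsum : (1 - χ (n : ZMod q)) * k (Real.log n) +
        (1 - conj (χ (n : ZMod q))) * k (-Real.log n) = ((2 * z.re : ℝ) : ℂ) := by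
      have : (1 - conj (χ (n : ZMod q))) * k (-Real.log n) = conj z := by
        rw [hz, hneg, map_mul, map_sub, map_one]
      rw [this, Complex.add_conj, Complex.ofReal_mul, Complex.ofReal_ofNat]
    rw [hsum, hc, ← Complex.ofReal_mul, Complex.ofReal_re]
    ring
  have hc2 : ((Λ 2 : ℝ) : ℂ) / (Real.sqrt (2 : ℕ) : ℂ) = ((Real.log 2 / Real.sqrt 2 : ℝ) : ℂ) := by
    rw [ArithmeticFunction.vonMangoldt_apply_prime Nat.prime_two]; push_cast; ring
  have hc3 : ((Λ 3 : ℝ) : ℂ) / (Real.sqrt (3 : ℕ) : ℂ) = ((Real.log 3 / Real.sqrt 3 : ℝ) : ℂ) := by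
    rw [ArithmeticFunction.vonMangoldt_apply_prime Nat.prime_three]; push_cast; ring
  have hc4 : ((Λ 4 : ℝ) : ℂ) / (Real.sqrt (4 : ℕ) : ℂ) = ((Real.log 2 / 2 : ℝ) : ℂ) := by
    rw [show (4 : ℕ) = 2 ^ 2 by norm_num, ArithmeticFunction.vonMangoldt_apply_pow (by norm_num),
      ArithmeticFunction.vonMangoldt_apply_prime Nat.prime_two]
    have : Real.sqrt ((2 ^ 2 : ℕ) : ℝ) = 2 := by
      rw [show ((2 ^ 2 : ℕ) : ℝ) = (2 : ℝ) ^ 2 by norm_num, Real.sqrt_sq (by norm_num)]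
    rw [this]; push_cast; ring
  have h2 := hterm 2 _ hc2
  have h3 := hterm 3 _ hc3
  have h4 := hterm 4 _ hc4
  simp only [Nat.cast_ofNat] at h2 h3 h4 ⊢
  rw [h2, h3, h4]
  ring

/-! ## The frontier transfer -/

/-- **TRANSFER UP TO THE `ζ` FRONTIER, ANY χ.** Let `log 3 < 2a ≤ log 5`, `log 2 ≤ a`, `q ≠ 1`, `χ` mod
`q`, `κ = (log 3/√3)‖1 − χ(3)‖`, `δ ≥ 2(log 2/√2)‖1 − χ(2)‖ + (log 2/2)‖1 − χ(4)‖`, `κ + δ < B ≤ log q`,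
`B₃ = B − δ`, `m = log 3 − a` and `C_M, C_A, I_A` the closed forms on `[m, a]` reflected at `log 3`. If Weil
positivity for `ζ` holds on `[-a, a]` and `2·[C_M (B₃² − κ²) + 2B₃ (B₃ C_A − (log 3/√3)Re(1 − χ(3)) I_A)]
≤ B₃ (B₃² − κ²)` then `WeilPositivityOnChar χ a`. [cite: Weil1952FormulesExplicites, (11) and the «lemme» p. 262; Yoshida1992 §6] -/
theorem weilPositivityOnChar_transfer_frontier [NeZero q] {a : ℝ}
    (ha3 : Real.log 3 < 2 * a) (ha4 : Real.log 2 ≤ a) (ha5 : 2 * a ≤ Real.log 5)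
    (hζ : WeilPositivityOn a) (hq1 : q ≠ 1)
    (χ : DirichletCharacter ℂ q) {B κ δ : ℝ} (hBq : B ≤ Real.log q)
    (hκ : κ = Real.log 3 / Real.sqrt 3 * ‖1 - χ (3 : ZMod q)‖)
    (hδ : 2 * (Real.log 2 / Real.sqrt 2) * ‖1 - χ (2 : ZMod q)‖ +
      Real.log 2 / 2 * ‖1 - χ (4 : ZMod q)‖ ≤ δ) (hκB : κ + δ < B)
    {m CM CA IA : ℝ} (hm : m = Real.log 3 - a) (hCM : CM = Real.sinh m + m)
    (hCA : CA = (Real.sinh a - Real.sinh m + (a - m)) / 2)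
    (hIA : IA = (a - m) * Real.cosh (Real.log 3 / 2) / 2 + Real.sinh (a - Real.log 3 / 2))
    (hcrit : 2 * (CM * ((B - δ) ^ 2 - κ ^ 2) +
        2 * (B - δ) * ((B - δ) * CA - Real.log 3 / Real.sqrt 3 * (1 - χ (3 : ZMod q)).re * IA)) ≤
      (B - δ) * ((B - δ) ^ 2 - κ ^ 2)) :
    WeilPositivityOnChar χ a := by
  intro g hg hsupp
  set L₃ := Real.log 3 with hL₃
  set k₂ : ℝ := Real.log 2 / Real.sqrt 2 with hk₂
  set k₃ : ℝ := Real.log 3 / Real.sqrt 3 with hk₃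
  set k₄ : ℝ := Real.log 2 / 2 with hk₄
  set u : ℂ := 1 - χ (3 : ZMod q) with hu
  set u₂ : ℂ := 1 - χ (2 : ZMod q) with hu₂
  set u₄ : ℂ := 1 - χ (4 : ZMod q) with hu₄
  set r : ℝ := ‖u‖ with hr
  have hk₂0 : 0 < k₂ := div_pos (Real.log_pos (by norm_num)) (by positivity)
  have hk₃0 : 0 < k₃ := div_pos (Real.log_pos (by norm_num)) (by positivity)
  have hk₄0 : 0 < k₄ := div_pos (Real.log_pos (by norm_num)) (by norm_num)
  have hr0 : 0 ≤ r := norm_nonneg _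
  have hκ0 : 0 ≤ κ := by rw [hκ]; exact mul_nonneg hk₃0.le hr0
  have hδ0 : 0 ≤ δ := le_trans (by positivity) hδ
  set B₃ : ℝ := B - δ with hB₃
  have hκB₃ : κ < B₃ := by rw [hB₃]; linarith
  have ha9 : a ≤ Real.log 3 := by
    have h59 : Real.log 5 ≤ 2 * Real.log 3 := by
      rw [← Real.log_rpow (by norm_num), show ((3 : ℝ) ^ (2 : ℝ)) = 9 by norm_num]
      exact Real.log_le_log (by norm_num) (by norm_num)
    linarith
  have hlog4 : Real.log 4 = 2 * Real.log 2 := by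
    rw [← Real.log_rpow (by norm_num), show ((2 : ℝ) ^ (2 : ℝ)) = 4 by norm_num]
  obtain ⟨ω, hω, huω⟩ : ∃ ω : ℂ, ‖ω‖ = 1 ∧ u = (r : ℂ) * ω := by
    by_cases hu0 : u = 0
    · exact ⟨1, by simp, by simp [hr, hu0]⟩
    · have hr' : r ≠ 0 := by rw [hr]; exact norm_ne_zero_iff.2 hu0
      refine ⟨u / (r : ℂ), ?_, ?_⟩
      · rw [norm_div, Complex.norm_real, Real.norm_eq_abs, abs_of_nonneg hr0, hr, div_self]
        exact norm_ne_zero_iff.2 hu0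
      · rw [mul_div_cancel₀ _ (by exact_mod_cast hr')]
  have hωre : (r : ℝ) * ω.re = u.re := by
    rw [huω, Complex.re_ofReal_mul]
  set kL₃ := weilConv g (weilReflect g) L₃ with hkL₃
  set kL₂ := weilConv g (weilReflect g) (Real.log 2) with hkL₂
  set kL₄ := weilConv g (weilReflect g) (Real.log 4) with hkL₄
  set N : ℝ := ∫ x, ‖g x‖ ^ 2 with hN
  set c : ℂ := ∫ x, g x * (Real.cosh (x / 2) : ℂ) with hc
  obtain ⟨hW0, hineq⟩ := reflection_inequality_at hg hsupp ha3 ha9 hω hκ0 hκB₃ hm hCM hCA hIA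
  set W : ℝ := B₃ * N + 2 * κ * (ω * kL₃).re with hW
  set G : ℝ := CM / B₃ + (CA + ω.re * IA) / (B₃ + κ) + (CA - ω.re * IA) / (B₃ - κ) with hG
  have hB : 0 < B₃ := lt_of_le_of_lt hκ0 hκB₃
  have hBp : 0 < B₃ + κ := by linarith
  have hBm : 0 < B₃ - κ := by linarith
  have hκre : κ * ω.re = k₃ * u.re := by
    rw [hκ, ← hωre, hk₃, hr]; ring
  have hGB : G * (B₃ * ((B₃ + κ) * (B₃ - κ))) =
      CM * (B₃ ^ 2 - κ ^ 2) + 2 * B₃ * (B₃ * CA - k₃ * u.re * IA) := by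
    rw [hG, ← hκre]; field_simp; ring
  have h2G : 2 * G ≤ 1 := by
    have hpos : 0 < B₃ * ((B₃ + κ) * (B₃ - κ)) := by positivity
    refine le_of_mul_le_mul_right ?_ hpos
    calc 2 * G * (B₃ * ((B₃ + κ) * (B₃ - κ))) = 2 * (G * (B₃ * ((B₃ + κ) * (B₃ - κ)))) := by ring
      _ = 2 * (CM * (B₃ ^ 2 - κ ^ 2) + 2 * B₃ * (B₃ * CA - k₃ * u.re * IA)) := by rw [hGB]
      _ ≤ B₃ * (B₃ ^ 2 - κ ^ 2) := hcrit
      _ = 1 * (B₃ * ((B₃ + κ) * (B₃ - κ))) := by ring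
  have hc2 : 2 * ‖c‖ ^ 2 ≤ W := by
    have h1 : ‖c‖ ^ 2 ≤ W * G := hineq
    have hWG : W * (2 * G) ≤ W * 1 := mul_le_mul_of_nonneg_left h2G hW0
    linarith only [h1, hWG]
  have hk : tsupport (weilConv g (weilReflect g)) ⊆ Icc (-Real.log 5) (Real.log 5) :=
    (tsupport_weilConv_weilReflect_subset hg.2 hsupp).trans (Icc_subset_Icc (by linarith) ha5)
  have hD := re_weilPrimeTerm_sub_weilPrimeTermChar_three χ hg hk
  have hDW : 2 * κ * (ω * kL₃).re = 2 * k₃ * (u * kL₃).re := by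
    rw [huω, mul_assoc (r : ℂ), Complex.re_ofReal_mul, hκ, hk₃, hr]
    ring
  -- the prime powers `2` and `4`, crudely
  have hN0 : 0 ≤ N := integral_nonneg fun t ↦ by positivity
  have hk2N : ‖kL₂‖ ≤ N := norm_weilConv_weilReflect_le hg _
  have hk4N : 2 * ‖kL₄‖ ≤ N := by
    refine two_mul_norm_weilConv_weilReflect_le hg hsupp ?_ ?_
    · have h516 : Real.log 5 < Real.log 16 := Real.log_lt_log (by norm_num) (by norm_num)
      rw [show (16 : ℝ) = 2 ^ 4 by norm_num, Real.log_pow] at h516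
      push_cast at h516
      rw [hlog4]; linarith
    · rw [hlog4]; linarith
  have h24 : -(δ * N) ≤ 2 * k₂ * (u₂ * kL₂).re + 2 * k₄ * (u₄ * kL₄).re := by
    have h1 : |(u₂ * kL₂).re| ≤ ‖u₂‖ * ‖kL₂‖ := by
      rw [← norm_mul]; exact Complex.abs_re_le_norm _
    have h1' : |(u₄ * kL₄).re| ≤ ‖u₄‖ * ‖kL₄‖ := by
      rw [← norm_mul]; exact Complex.abs_re_le_norm _
    have h5 := mul_le_mul_of_nonneg_left (abs_le.1 h1).1 (by positivity : (0 : ℝ) ≤ 2 * k₂)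
    have h5' := mul_le_mul_of_nonneg_left (abs_le.1 h1').1 (by positivity : (0 : ℝ) ≤ 2 * k₄)
    have h6 : 2 * k₂ * (‖u₂‖ * ‖kL₂‖) ≤ 2 * k₂ * (‖u₂‖ * N) :=
      mul_le_mul_of_nonneg_left (mul_le_mul_of_nonneg_left hk2N (norm_nonneg _)) (by positivity)
    have h6' : k₄ * (‖u₄‖ * (2 * ‖kL₄‖)) ≤ k₄ * (‖u₄‖ * N) :=
      mul_le_mul_of_nonneg_left (mul_le_mul_of_nonneg_left hk4N (norm_nonneg _)) hk₄0.le
    have h7 : (2 * k₂ * ‖u₂‖ + k₄ * ‖u₄‖) * N ≤ δ * N := mul_le_mul_of_nonneg_right hδ hN0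
    linarith only [h5, h5', h6, h6', h7]
  have hmain := re_weilQuadraticChar_ge hq1 χ hg
  have hζg : 0 ≤ (weilQuadratic g).re := hζ g hg hsupp
  have hP := two_mul_re_weilMellin_le hg
  have hNB : B * N ≤ N * Real.log q := by
    have h := mul_le_mul_of_nonneg_left hBq hN0
    rwa [mul_comm N B] at h
  rw [hD] at hmain
  rw [hW, hDW, hB₃] at hc2
  simp only [hkL₂, hkL₃, hkL₄, hu, hu₂, hu₄, hk₂, hk₃, hk₄, hL₃, hN, hc] at hc2 h24 hNB
  linarith

/-! ## The frontier for every character of large modulus -/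

set_option maxHeartbeats 400000 in
/-- The frontier rung `4023/5000` from the bounded criterion: `B ≤ log q`, `1.3 + δ ≤ B`, `δ` as in the
transfer, `σ₀ ≤ ‖1 − χ(3)‖² ≤ σ₁ ≤ 4`, rational checks at `σ₀, σ₁`.
[cite: Weil1952FormulesExplicites, the «lemme» p. 262; Yoshida1992 §6] -/
theorem weilPositivityOnChar_frontier_of_curve_general [NeZero q] (hq1 : q ≠ 1)
    (χ : DirichletCharacter ℂ q) {B δ σ₀ σ₁ : ℝ} (hBq : B ≤ Real.log q) (hB1 : 1.3 + δ ≤ B)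
    (hδ : 2 * (Real.log 2 / Real.sqrt 2) * ‖1 - χ (2 : ZMod q)‖ +
      Real.log 2 / 2 * ‖1 - χ (4 : ZMod q)‖ ≤ δ)
    (hσ₀ : σ₀ ≤ ‖1 - χ (3 : ZMod q)‖ ^ 2) (hσ₁ : ‖1 - χ (3 : ZMod q)‖ ^ 2 ≤ σ₁) (hσ₀0 : 0 ≤ σ₀)
    (hσ₁4 : σ₁ ≤ 4)
    (h0 : 2 * (0.59228 * ((B - δ) ^ 2 - 0.63428 ^ 2 * σ₀) +
        2 * (B - δ) * ((B - δ) * 0.5533 - 0.63428 * (σ₀ / 2) * 0.55286)) ≤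
      (B - δ) * ((B - δ) ^ 2 - 0.6343 ^ 2 * σ₀))
    (h1 : 2 * (0.59228 * ((B - δ) ^ 2 - 0.63428 ^ 2 * σ₁) +
        2 * (B - δ) * ((B - δ) * 0.5533 - 0.63428 * (σ₁ / 2) * 0.55286)) ≤
      (B - δ) * ((B - δ) ^ 2 - 0.6343 ^ 2 * σ₁)) :
    WeilPositivityOnChar χ (4023 / 5000) := by
  obtain ⟨hCM, hCA, hIA⟩ := frontier_constants_three
  set k₃ := Real.log 3 / Real.sqrt 3 with hk₃
  set u : ℂ := 1 - χ (3 : ZMod q) with hu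
  have hδ0 : 0 ≤ δ := le_trans (by positivity) hδ
  have hB' : 0 < B - δ := by linarith
  have hsq : (1.69 : ℝ) ≤ (B - δ) ^ 2 := by nlinarith
  have hk0 : 0 ≤ k₃ := le_trans (by norm_num) kthree_ge
  have hIA0 : (0 : ℝ) ≤ (4023 / 5000 - (Real.log 3 - 4023 / 5000)) * Real.cosh (Real.log 3 / 2) / 2 +
      Real.sinh (4023 / 5000 - Real.log 3 / 2) := by linarith
  have hend : ∀ s : ℝ, 0 ≤ s → s ≤ 4 →
      2 * (0.59228 * ((B - δ) ^ 2 - 0.63428 ^ 2 * s) +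
        2 * (B - δ) * ((B - δ) * 0.5533 - 0.63428 * (s / 2) * 0.55286)) ≤
          (B - δ) * ((B - δ) ^ 2 - 0.6343 ^ 2 * s) →
      2 * ((Real.sinh (Real.log 3 - 4023 / 5000) + (Real.log 3 - 4023 / 5000)) *
          ((B - δ) ^ 2 - k₃ ^ 2 * s) +
        2 * (B - δ) * ((B - δ) * ((Real.sinh (4023 / 5000) - Real.sinh (Real.log 3 - 4023 / 5000) +
          (4023 / 5000 - (Real.log 3 - 4023 / 5000))) / 2) -
          k₃ * (s / 2) * ((4023 / 5000 - (Real.log 3 - 4023 / 5000)) * Real.cosh (Real.log 3 / 2) / 2 +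
            Real.sinh (4023 / 5000 - Real.log 3 / 2)))) ≤ (B - δ) * ((B - δ) ^ 2 - k₃ ^ 2 * s) :=
    fun s hs0 hs4 hnum ↦ reflection_criterion_of_bounds hCM hCA hIA (by norm_num) (by linarith) hs0
      kthree_ge kthree_le (by norm_num) hB' (by norm_num) (by nlinarith [hsq, hs4]) hnum
  have hσ3 : ‖1 - χ (3 : ZMod q)‖ ^ 2 ≤ 4 := by
    have h : ‖1 - χ (3 : ZMod q)‖ ≤ 2 := norm_one_sub_char_three_le χ
    nlinarith [norm_nonneg (1 - χ (3 : ZMod q))]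
  have hcrit := reflection_criterion_interpolate (ρ := u.re) hk0 hIA0 hB'.le
    (hend σ₀ hσ₀0 (by linarith) h0) (hend σ₁ (by linarith) hσ₁4 h1) hσ₀ hσ₁
    (normSq_one_sub_half_le_re (χ.norm_le_one _))
  have hl3 := Real.log_three_lt_d9
  have hl5 := Real.log_five_gt_d9
  have hl2 := Real.log_two_lt_d9
  refine weilPositivityOnChar_transfer_frontier (B := B) (κ := k₃ * ‖u‖) (δ := δ)
    (by linarith) (by linarith) (by linarith)
    Summit.RiemannHypothesis.RiemannHypothesis.Theorems.EvenWinsBeyondArch.weilPositivityOn_8046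
    hq1 χ hBq (by rw [hk₃, hu]) hδ ?_ rfl rfl rfl rfl ?_
  · have h2 : ‖u‖ ≤ 2 := by nlinarith [hσ3, norm_nonneg u]
    have := mul_le_mul kthree_le h2 (norm_nonneg _) (by norm_num)
    nlinarith [norm_nonneg u]
  · rw [mul_pow]
    exact hcrit

/-- `‖1 − χ(n)‖ ≤ 2` for any value of a Dirichlet character. [folklore] -/
theorem norm_one_sub_char_le (χ : DirichletCharacter ℂ q) (n : ZMod q) : ‖1 - χ n‖ ≤ 2 :=
  calc ‖1 - χ n‖ ≤ ‖(1 : ℂ)‖ + ‖χ n‖ := norm_sub_le _ _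
    _ ≤ 1 + 1 := by rw [norm_one]; exact add_le_add le_rfl (χ.norm_le_one _)
    _ = 2 := by norm_num

/-- **THE `ζ` FRONTIER FOR EVERY DIRICHLET CHARACTER OF EVERY MODULUS `q ≥ 450`**:
`WeilPositivityOnChar χ (4023/5000)` (`δ = 2.65372 ≥ 4k₂' + 2k₄'`, `B = 6.109 ≤ log 2 + 2 log 3 + 2 log 5`).
[cite: Weil1952FormulesExplicites, the «lemme» p. 262; Yoshida1992 §6] -/
theorem weilPositivityOnChar_frontier_of_ge_450 (hq : 450 ≤ q) (χ : DirichletCharacter ℂ q) :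
    WeilPositivityOnChar χ (4023 / 5000) := by
  have hq1 : q ≠ 1 := by omega
  haveI : NeZero q := ⟨by omega⟩
  have hBq : (6.109 : ℝ) ≤ Real.log q := by
    have h := Real.log_le_log (by norm_num) (by exact_mod_cast hq : (450 : ℝ) ≤ q)
    rw [show (450 : ℝ) = 2 * 3 ^ 2 * 5 ^ 2 by norm_num, Real.log_mul (by norm_num) (by norm_num),
      Real.log_mul (by norm_num) (by norm_num), Real.log_pow, Real.log_pow] at h
    push_cast at h
    linarith [Real.log_two_gt_d9, Real.log_three_gt_d9, Real.log_five_gt_d9]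
  have hδ : 2 * (Real.log 2 / Real.sqrt 2) * ‖1 - χ (2 : ZMod q)‖ +
      Real.log 2 / 2 * ‖1 - χ (4 : ZMod q)‖ ≤ 2.65372 := by
    have h2 := mul_le_mul kprime_bounds.2 (norm_one_sub_char_le χ 2) (norm_nonneg _) (by norm_num)
    have h4 := mul_le_mul_of_nonneg_left (norm_one_sub_char_le χ 4)
      (by positivity : (0:ℝ) ≤ Real.log 2 / 2)
    linarith [Real.log_two_lt_d9]
  have hσ3 : ‖1 - χ (3 : ZMod q)‖ ^ 2 ≤ 4 := by
    nlinarith [norm_one_sub_char_le χ 3, norm_nonneg (1 - χ (3 : ZMod q))]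
  exact weilPositivityOnChar_frontier_of_curve_general hq1 χ hBq (by norm_num) hδ
    (sq_nonneg _) hσ3 le_rfl le_rfl (by norm_num) (by norm_num)

/-- **The `ζ` frontier for every character of EVEN modulus `q ≥ 128`** (`χ(2) = χ(4) = 0`, `δ = 1.32686`,
`B = 4.852 ≤ 7 log 2`). [cite: Weil1952FormulesExplicites, the «lemme» p. 262; Yoshida1992 §6] -/
theorem weilPositivityOnChar_frontier_of_even_ge_128 (hq : 128 ≤ q) (heven : Even q)
    (χ : DirichletCharacter ℂ q) : WeilPositivityOnChar χ (4023 / 5000) := by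
  have hq1 : q ≠ 1 := by omega
  haveI : NeZero q := ⟨by omega⟩
  have hnu : ∀ n : ℕ, 2 ∣ n → χ (n : ZMod q) = 0 := by
    intro n hn
    refine χ.map_nonunit fun hunit ↦ ?_
    have hcop := (ZMod.isUnit_iff_coprime n q).1 (by exact_mod_cast hunit)
    obtain ⟨r, hr⟩ := heven
    have h2 : 2 ∣ q := ⟨r, by omega⟩
    have := Nat.Coprime.eq_one_of_dvd (Nat.Coprime.coprime_dvd_left hn hcop) h2
    omega
  have hχ2 : χ (2 : ZMod q) = 0 := by exact_mod_cast hnu 2 (dvd_refl 2)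
  have hχ4 : χ (4 : ZMod q) = 0 := by exact_mod_cast hnu 4 (by norm_num)
  have hBq : (4.852 : ℝ) ≤ Real.log q := by
    have h := Real.log_le_log (by norm_num) (by exact_mod_cast hq : (128 : ℝ) ≤ q)
    rw [show (128 : ℝ) = 2 ^ 7 by norm_num, Real.log_pow] at h
    push_cast at h
    linarith [Real.log_two_gt_d9]
  have hδ : 2 * (Real.log 2 / Real.sqrt 2) * ‖1 - χ (2 : ZMod q)‖ +
      Real.log 2 / 2 * ‖1 - χ (4 : ZMod q)‖ ≤ 1.32686 := by
    rw [hχ2, hχ4, sub_zero, norm_one, mul_one, mul_one]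
    linarith [kprime_bounds.2, Real.log_two_lt_d9]
  have hσ3 : ‖1 - χ (3 : ZMod q)‖ ^ 2 ≤ 4 := by
    nlinarith [norm_one_sub_char_le χ 3, norm_nonneg (1 - χ (3 : ZMod q))]
  exact weilPositivityOnChar_frontier_of_curve_general hq1 χ hBq (by norm_num) hδ
    (sq_nonneg _) hσ3 le_rfl le_rfl (by norm_num) (by norm_num)

/-- **The `ζ` frontier for `q ≥ 225` when `χ(2) = −1`** (`χ(4) = 1`, `δ = 1.96056`, `B = 5.416 ≤ 2 log 3 +
2 log 5`). [cite: Weil1952FormulesExplicites, the «lemme» p. 262; Yoshida1992 §6] -/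
theorem weilPositivityOnChar_frontier_of_chi_two_neg_one (hq : 225 ≤ q) (χ : DirichletCharacter ℂ q)
    (hχ2 : χ (2 : ZMod q) = -1) : WeilPositivityOnChar χ (4023 / 5000) := by
  have hq1 : q ≠ 1 := by omega
  haveI : NeZero q := ⟨by omega⟩
  have hχ4 : χ (4 : ZMod q) = 1 := by
    rw [show (4 : ZMod q) = 2 * 2 by norm_num, map_mul, hχ2]; norm_num
  have hBq : (5.416 : ℝ) ≤ Real.log q := by
    have h := Real.log_le_log (by norm_num) (by exact_mod_cast hq : (225 : ℝ) ≤ q)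
    rw [show (225 : ℝ) = 3 ^ 2 * 5 ^ 2 by norm_num, Real.log_mul (by norm_num) (by norm_num),
      Real.log_pow, Real.log_pow] at h
    push_cast at h
    linarith [Real.log_three_gt_d9, Real.log_five_gt_d9]
  have hδ : 2 * (Real.log 2 / Real.sqrt 2) * ‖1 - χ (2 : ZMod q)‖ +
      Real.log 2 / 2 * ‖1 - χ (4 : ZMod q)‖ ≤ 1.96056 := by
    rw [hχ2, hχ4, sub_neg_eq_add, sub_self, norm_zero, mul_zero, add_zero,
      show (1 : ℂ) + 1 = 2 by norm_num, Complex.norm_two]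
    linarith [kprime_bounds.2]
  have hσ3 : ‖1 - χ (3 : ZMod q)‖ ^ 2 ≤ 4 := by
    nlinarith [norm_one_sub_char_le χ 3, norm_nonneg (1 - χ (3 : ZMod q))]
  exact weilPositivityOnChar_frontier_of_curve_general hq1 χ hBq (by norm_num) hδ
    (sq_nonneg _) hσ3 le_rfl le_rfl (by norm_num) (by norm_num)

end Summit.Ventures.WeilGRH
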